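import Summits.ResolutionOfSingularities.ResolutionOfSingularities.Theses.HilbertSamuelElimination
import Literature.AlgebraicGeometry.Resolution.HilbertSamuelStrata
import Mathlib.RingTheory.DualNumber
import Mathlib.AlgebraicGeometry.Morphisms.FiniteType

/-!
# `ModificationsResolve` (crux stmt-ResolutionOfSingularities-18507), line `Sketch`:
# `stub_dense_compl_hsMaxLocus` — and the route's support `MaxLocusNowhereDense` — are FALSE
# without reducedness: the fat point `Spec k[ε]/(ε²)`
# (negative-side support, refuter cdisprove seat; refutes nothing in `Theses/`)

The lead's `stub_dense_compl_hsMaxLocus` (`Y` reduced, locally of finite type over a field, not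
regular, `dim Y ≤ N` ⟹ `Y ∖ Y_max` dense) and the route's support item `MaxLocusNowhereDense`
(stmt-18776; `X` reduced …, `dim X < N` ⟹ `X_max` non-empty, closed, nowhere dense) both carry
`IsReduced`. We record, sorry-free and definition-free, that this hypothesis is load-bearing:

* `stub_dense_compl_hsMaxLocus_false_without_isReduced` — for every field `k` and every `N`, the
  fat point `Y = Spec k[ε]` (`ε² = 0`) is of finite type over `k`, of dimension `0 ≤ N`, NOT
  regular (its local ring `k[ε]` is not a domain), yet `Y_max = Y` (one point, one value), so
  `Y ∖ Y_max = ∅` is not dense;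
* `maxLocusNowhereDense_false_without_isReduced` — hence `MaxLocusNowhereDense` with the
  hypothesis `IsReduced X` deleted (everything else verbatim) is false (instance `p = 2`,
  `k = ZMod 2`, `X = Spec k[ε]`, `N = 1`).

This is exactly why CJS (LNM 2270) Cor. 6.19, the non-reduced companion of Cor. 6.18, replaces
"non-regular" by "not (locally) equisingular" (tree: `Scheme.IsLocallyEquisingular`): on a
non-reduced scheme `H_X` can be constant without `X` being regular, and then `X_max = X`.
-/

/-- **Record of the dropped route item `MaxLocusNowhereDense`** = stmt-ResolutionOfSingularities-18776 (ledger signature verbatim; NOT a route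
item): route HilbertSamuelElimination replaced `MaxLocusNowhereDense` (stmt-18508 → stmt-18776, 2026-08-17T03:00Z) and later dropped the stmt-18776 decl (closed moot) from the route file. The declaration `Summit.ResolutionOfSingularities.ResolutionOfSingularities.Theses.HilbertSamuelElimination.MaxLocusNowhereDense`
therefore no longer exists in the route file and this accepted module stopped elaborating (stale olean;
buildfix lane 2026-08-19). Re-created here under its original name so the result keeps building; the
statement of every previously accepted declaration in this file is unchanged. -/
def _root_.Summit.ResolutionOfSingularities.ResolutionOfSingularities.Theses.HilbertSamuelElimination.MaxLocusNowhereDense : Prop :=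
  ∀ p : ℕ, p.Prime → ∀ (k : Type) [Field k] [CharP k p] (X : AlgebraicGeometry.Scheme.{0}) (f : X ⟶ AlgebraicGeometry.Spec (.of k)), AlgebraicGeometry.IsSeparated f → AlgebraicGeometry.LocallyOfFiniteType f → AlgebraicGeometry.QuasiCompact f → AlgebraicGeometry.IsReduced X → ¬ Literature.AlgebraicGeometry.Resolution.Scheme.IsRegular X → ∀ N : ℕ, topologicalKrullDim X < (N : WithBot ℕ∞) → let H : (Y : AlgebraicGeometry.Scheme.{0}) → Y → ℕ → ℕ := fun Y y => Literature.RingTheory.HilbertSamuel.hilbertSamuelFun (Y.presheaf.stalk y) (N - Literature.RingTheory.HilbertSamuel.minimalPrimesCodim (Y.presheaf.stalk y)); {x : X | Maximal (· ∈ Set.range (H X)) (H X x)}.Nonempty ∧ IsClosed {x : X | Maximal (· ∈ Set.range (H X)) (H X x)} ∧ Dense {x : X | Maximal (· ∈ Set.range (H X)) (H X x)}ᶜ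


noncomputable section

set_option linter.dupNamespace false

namespace Summit.ResolutionOfSingularities.ResolutionOfSingularities.Theorems.ModificationsResolve.Negative

open CategoryTheory AlgebraicGeometry TopologicalSpace
open Literature.AlgebraicGeometry.Resolution
open scoped DualNumber

section FatPoint

variable (k : Type) [Field k]

/-- `ε ≠ 0` in `k[ε]`. -/
theorem dualNumber_eps_ne_zero : (DualNumber.eps : k[ε]) ≠ 0 := fun h => by
  have := congrArg TrivSqZeroExt.snd h
  simp at this

/-- `k[ε]` is not a domain (`ε · ε = 0`). -/
theorem dualNumber_not_isDomain : ¬ IsDomain k[ε] := fun h => by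
  have h2 : (DualNumber.eps : k[ε]) * DualNumber.eps = 0 := DualNumber.eps_mul_eps
  rcases mul_eq_zero.mp h2 with h3 | h3 <;> exact dualNumber_eps_ne_zero k h3

/-- The only prime ideal of `k[ε]` is `(ε)`, its maximal ideal. -/
theorem dualNumber_eq_maximalIdeal_of_isPrime (p : Ideal k[ε]) [hp : p.IsPrime] :
    p = IsLocalRing.maximalIdeal k[ε] := by
  rcases DualNumber.ideal_trichotomy p with h | h | h
  · exfalso
    have : (DualNumber.eps : k[ε]) * DualNumber.eps ∈ p := by
      rw [DualNumber.eps_mul_eps]; exact p.zero_mem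
    rcases hp.mem_or_mem this with h1 | h1 <;>
    · rw [h] at h1; exact dualNumber_eps_ne_zero k (Ideal.mem_bot.mp h1)
  · rw [h, DualNumber.maximalIdeal_eq_span_singleton_eps]
  · exact absurd h hp.ne_top

/-- `Spec k[ε]` has exactly one point. -/
theorem subsingleton_spec_dualNumber : Subsingleton (Spec (CommRingCat.of k[ε]) : Scheme.{0}) :=
  ⟨fun p q => PrimeSpectrum.ext ((dualNumber_eq_maximalIdeal_of_isPrime k p.asIdeal).trans
    (dualNumber_eq_maximalIdeal_of_isPrime k q.asIdeal).symm)⟩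

/-- **The fat point is not regular**: its stalk is `k[ε]` localised at the maximal ideal, i.e.
`k[ε]`, which is not a domain, whereas regular local rings are domains. -/
theorem not_isRegular_spec_dualNumber : ¬ Scheme.IsRegular (Spec (CommRingCat.of k[ε])) := by
  intro h
  let x : (Spec (CommRingCat.of k[ε]) : Scheme.{0}) := ⟨IsLocalRing.maximalIdeal k[ε], inferInstance⟩
  haveI : IsRegularLocalRing ((Spec (CommRingCat.of k[ε])).presheaf.stalk x) := h x
  haveI : IsDomain ((Spec (CommRingCat.of k[ε])).presheaf.stalk x) :=
    isDomain_of_isRegularLocalRing _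
  have hle : (IsLocalRing.maximalIdeal k[ε]).primeCompl ≤ IsUnit.submonoid k[ε] := by
    intro a ha
    have ha' : a ∉ IsLocalRing.maximalIdeal k[ε] := ha
    rwa [IsLocalRing.mem_maximalIdeal, mem_nonunits_iff, not_not] at ha'
  have e1 : k[ε] ≃+* Localization.AtPrime (IsLocalRing.maximalIdeal k[ε]) :=
    (IsLocalization.atUnits k[ε] (IsLocalRing.maximalIdeal k[ε]).primeCompl hle).toRingEquiv
  have e2 : Localization.AtPrime (IsLocalRing.maximalIdeal k[ε]) ≃+*
      ((Spec (CommRingCat.of k[ε])).presheaf.stalk x) :=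
    (Spec.stalkIso (CommRingCat.of k[ε]) x).commRingCatIsoToRingEquiv.symm
  exact dualNumber_not_isDomain k (MulEquiv.isDomain _ (e1.trans e2).toMulEquiv)

/-- The fat point has dimension `0`. -/
theorem topologicalKrullDim_spec_dualNumber :
    topologicalKrullDim (Spec (CommRingCat.of k[ε]) : Scheme.{0}) = 0 := by
  haveI := subsingleton_spec_dualNumber k
  letI : Unique (PrimeSpectrum k[ε]) :=
    { default := ⟨IsLocalRing.maximalIdeal k[ε], inferInstance⟩
      uniq := fun p => Subsingleton.elim (α := (Spec (CommRingCat.of k[ε]) : Scheme.{0})) _ _ }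
  change topologicalKrullDim (PrimeSpectrum k[ε]) = 0
  rw [PrimeSpectrum.topologicalKrullDim_eq_ringKrullDim, ringKrullDim,
    Order.krullDim_eq_zero_of_unique]

/-- On the fat point every level-`N` Hilbert–Samuel locus is everything (one point, one value). -/
theorem hsMaxLocus_spec_dualNumber (N : ℕ) :
    Scheme.hsMaxLocus (Spec (CommRingCat.of k[ε])) N = Set.univ := by
  haveI := subsingleton_spec_dualNumber k
  refine Set.eq_univ_of_forall fun x => ⟨⟨x, rfl⟩, ?_⟩
  rintro ν ⟨y, rfl⟩ -
  rw [Subsingleton.elim y x]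

/-- `Spec k[ε] → Spec k` is locally of finite type (`k[ε]` is a finite `k`-module). -/
theorem locallyOfFiniteType_spec_dualNumber :
    LocallyOfFiniteType (Spec.map (CommRingCat.ofHom (algebraMap k k[ε]))) := by
  rw [HasRingHomProperty.Spec_iff (P := @LocallyOfFiniteType)]
  change (algebraMap k k[ε]).FiniteType
  rw [RingHom.finiteType_algebraMap]
  haveI : Module.Finite k k[ε] := inferInstanceAs (Module.Finite k (k × k))
  infer_instance

/-- **`stub_dense_compl_hsMaxLocus` is false without `IsReduced Y`**, at every field and every
level: witness the fat point `Spec k[ε]`. -/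
theorem stub_dense_compl_hsMaxLocus_false_without_isReduced (N : ℕ) :
    ∃ (Y : Scheme.{0}) (g : Y ⟶ Spec (.of k)), LocallyOfFiniteType g ∧ ¬ Scheme.IsRegular Y ∧
      topologicalKrullDim Y ≤ (N : WithBot ℕ∞) ∧ ¬ Dense (Scheme.hsMaxLocus Y N)ᶜ := by
  refine ⟨Spec (.of k[ε]), Spec.map (CommRingCat.ofHom (algebraMap k k[ε])),
    locallyOfFiniteType_spec_dualNumber k, not_isRegular_spec_dualNumber k, ?_, ?_⟩
  · rw [topologicalKrullDim_spec_dualNumber]; exact_mod_cast Nat.zero_le N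
  · rw [hsMaxLocus_spec_dualNumber, Set.compl_univ]
    intro h
    have := h.nonempty
    simp at this

end FatPoint

/-- **`MaxLocusNowhereDense` (stmt-18776) with its hypothesis `IsReduced X` deleted is false**
(all other clauses verbatim; instance `p = 2`, `k = ZMod 2`, `X = Spec k[ε]`, `N = 1`: the
nowhere-density conjunct fails). The inline `H` / max-locus are `Scheme.hsFun` / `Scheme.hsMaxLocus`
by `rfl`. -/
theorem maxLocusNowhereDense_false_without_isReduced :
    ¬ (∀ p : ℕ, p.Prime → ∀ (k : Type) [Field k] [CharP k p] (X : AlgebraicGeometry.Scheme.{0}) (f : X ⟶ AlgebraicGeometry.Spec (.of k)), AlgebraicGeometry.IsSeparated f → AlgebraicGeometry.LocallyOfFiniteType f → AlgebraicGeometry.QuasiCompact f → ¬ Literature.AlgebraicGeometry.Resolution.Scheme.IsRegular X → ∀ N : ℕ, topologicalKrullDim X < (N : WithBot ℕ∞) → let H : (Y : AlgebraicGeometry.Scheme.{0}) → Y → ℕ → ℕ := fun Y y => Literature.RingTheory.HilbertSamuel.hilbertSamuelFun (Y.presheaf.stalk y) (N - Literature.RingTheory.HilbertSamuel.minimalPrimesCodim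 (Y.presheaf.stalk y)); {x : X | Maximal (· ∈ Set.range (H X)) (H X x)}.Nonempty ∧ IsClosed {x : X | Maximal (· ∈ Set.range (H X)) (H X x)} ∧ Dense {x : X | Maximal (· ∈ Set.range (H X)) (H X x)}ᶜ) := by
  intro h
  haveI : Fact (Nat.Prime 2) := ⟨Nat.prime_two⟩
  have hlt : topologicalKrullDim (Spec (CommRingCat.of (ZMod 2)[ε]) : Scheme.{0}) < ((1 : ℕ) : WithBot ℕ∞) := by
    rw [topologicalKrullDim_spec_dualNumber]; exact_mod_cast Nat.zero_lt_one
  haveI := locallyOfFiniteType_spec_dualNumber (ZMod 2)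
  obtain ⟨-, -, hdense⟩ := h 2 Nat.prime_two (ZMod 2) (Spec (.of (ZMod 2)[ε]))
    (Spec.map (CommRingCat.ofHom (algebraMap (ZMod 2) (ZMod 2)[ε]))) inferInstance inferInstance
    inferInstance (not_isRegular_spec_dualNumber (ZMod 2)) 1 hlt
  change Dense (Scheme.hsMaxLocus (Spec (CommRingCat.of (ZMod 2)[ε])) 1)ᶜ at hdense
  rw [hsMaxLocus_spec_dualNumber, Set.compl_univ] at hdense
  have := hdense.nonempty
  simp at this

/-- Sanity: the statement negated above is `MaxLocusNowhereDense` with exactly the hypothesis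
`IsReduced X` removed — the route's support item implies it once `IsReduced X` is re-inserted. -/
theorem maxLocusNowhereDense_imp (hM : Summit.ResolutionOfSingularities.ResolutionOfSingularities.Theses.HilbertSamuelElimination.MaxLocusNowhereDense)
    (p : ℕ) (hp : p.Prime) (k : Type) [Field k] [CharP k p] (X : AlgebraicGeometry.Scheme.{0})
    (f : X ⟶ AlgebraicGeometry.Spec (.of k)) (hs : AlgebraicGeometry.IsSeparated f)
    (hl : AlgebraicGeometry.LocallyOfFiniteType f) (hq : AlgebraicGeometry.QuasiCompact f)
    (hr : AlgebraicGeometry.IsReduced X) (hX : ¬ Literature.AlgebraicGeometry.Resolution.Scheme.IsRegular X)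
    (N : ℕ) (hN : topologicalKrullDim X < (N : WithBot ℕ∞)) :
    (Scheme.hsMaxLocus X N).Nonempty ∧ IsClosed (Scheme.hsMaxLocus X N) ∧
      Dense (Scheme.hsMaxLocus X N)ᶜ :=
  hM p hp k X f hs hl hq hr hX N hN

end Summit.ResolutionOfSingularities.ResolutionOfSingularities.Theorems.ModificationsResolve.Negative

end
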